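import Mathlib
import Summits.NavierStokesRegularity.NavierStokesRegularity.Theorems.WakeRatchetAdmissibleEternalBoundFedSpike
import HarnessLib

/-!
# The DAMPED fed-spike machinery for admissible eternal solutions (support for
# `WakeRatchet.AdmissibleEternalBound`, stmt-NavierStokesRegularity-23197): Grönwall fence with a local
# derivative bound, and the derivative bound for the damped weight `e^{(1+Γ)σ}‖W_k‖`

Tools for the a-priori dissipative shell step (companion file
`WakeRatchetAdmissibleEternalBoundDissipativeStep`): in the dissipation range the renormalised shell
energy `ẽ_k = e^{2σ}‖W_k‖²` is damped at rate `2·viscCoef(k,σ) = 2ν̂(1+ε₀)^{2k}e^{-σ}`, which on a left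
half-line `(-∞, σ]` is at least `2Γ`, `Γ = viscCoef(k, σ)` (`viscCoef_anti_time`); the weight
`e^{2Γσ}` can therefore be absorbed (`hasDerivAt_renE_damped`, `renE_damped_deriv_le`), and the
Grönwall fence of `WakeRatchetAdmissibleEternalBoundFedSpike` is re-proved with the derivative bound
required on `[a, b)` only (`gronwall_sq_fence_on`).  `integral_exp_mul_le` is the elementary
`∫_a^σ e^{(1+Γ)s}ds ≤ e^{(1+Γ)σ}/(1+Γ)`.
MODEL lattice ODEs only (Tao 2016 §4, §6.4); nothing here concerns the Navier–Stokes equations.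
-/

noncomputable section

set_option linter.dupNamespace false

namespace Summit.NavierStokesRegularity.NavierStokesRegularity.Theorems

namespace WakeRatchetDampedFedSpike

open Filter Topology MeasureTheory Set intervalIntegral
open scoped RealInnerProductSpace
open Literature.Analysis.FluidPDE Literature.Analysis.FluidPDE.TaoCascade
open WakeRatchetFedSpike

/-! ## The Grönwall fence with a local derivative bound -/

/-- **Grönwall lemma for `h²` (fencing form), derivative bound needed on `[a, b)` only.**  Same
statement and proof as `WakeRatchetFedSpike.gronwall_sq_fence`, with the hypothesis on `D` localized
to `Ico a b` (needed when the damping floor holds on a left half-line only). [folklore] -/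
theorem gronwall_sq_fence_on {h D src cof : ℝ → ℝ} {κ a b : ℝ} (hab : a ≤ b) (hκ : 0 ≤ κ)
    (hh0 : ∀ x, 0 ≤ h x) (hE : ∀ x, HasDerivAt (fun x => h x ^ 2) (D x) x)
    (hD : ∀ x ∈ Ico a b, D x ≤ 2 * h x * src x + 2 * κ * cof x * h x ^ 2)
    (hsrc_c : Continuous src) (hcof_c : Continuous cof)
    (hsrc0 : ∀ s, 0 ≤ src s) (hcof0 : ∀ s, 0 ≤ cof s) :
    h b ≤ Real.exp (κ * ∫ s in a..b, cof s) * (h a + ∫ s in a..b, src s) := by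
  set E : ℝ → ℝ := fun x => h x ^ 2 with hEdef
  have hEc : Continuous E := continuous_iff_continuousAt.2 fun x => (hE x).continuousAt
  -- primitives of the source and of the coefficient
  set F : ℝ → ℝ := fun x => ∫ s in a..x, src s with hFdef
  set I : ℝ → ℝ := fun x => ∫ s in a..x, cof s with hIdef
  have hFd : ∀ x, HasDerivAt F (src x) x := fun x =>
    intervalIntegral.integral_hasDerivAt_right (hsrc_c.intervalIntegrable _ _)
      (hsrc_c.stronglyMeasurableAtFilter _ _) hsrc_c.continuousAt
  have hId : ∀ x, HasDerivAt I (cof x) x := fun x =>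
    intervalIntegral.integral_hasDerivAt_right (hcof_c.intervalIntegrable _ _)
      (hcof_c.stronglyMeasurableAtFilter _ _) hcof_c.continuousAt
  have hF0 : ∀ x, a ≤ x → 0 ≤ F x := fun x hx =>
    intervalIntegral.integral_nonneg hx fun s _ => hsrc0 s
  have hI0 : ∀ x, a ≤ x → 0 ≤ I x := fun x hx =>
    intervalIntegral.integral_nonneg hx fun s _ => hcof0 s
  have hFa : F a = 0 := by simp only [hFdef, intervalIntegral.integral_same]
  have hIa : I a = 0 := by simp only [hIdef, intervalIntegral.integral_same]
  set c₀ : ℝ := h a with hc₀def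
  have hc₀ : 0 ≤ c₀ := hh0 a
  -- the fence, for every `η > 0`
  have key : ∀ η : ℝ, 0 < η → h b ≤ (c₀ + F b + η * (1 + (b - a))) * Real.exp (κ * I b) := by
    intro η hη
    set B : ℝ → ℝ := fun x => (c₀ + F x + η * (1 + (x - a))) * Real.exp (κ * I x) with hBdef
    set B' : ℝ → ℝ := fun x => (src x + η) * Real.exp (κ * I x)
        + (c₀ + F x + η * (1 + (x - a))) * (Real.exp (κ * I x) * (κ * cof x)) with hB'def
    have hBd : ∀ x, HasDerivAt B (B' x) x := by
      intro x
      have hlin : HasDerivAt (fun x : ℝ => η * (1 + (x - a))) (η * 1) x := by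
        have h1 : HasDerivAt (fun x : ℝ => 1 + (x - a)) 1 x := by
          have := ((hasDerivAt_id x).sub_const a).const_add 1
          simpa using this
        exact h1.const_mul η
      have hA : HasDerivAt (fun x => c₀ + F x) (src x) x := by
        have := (hFd x).const_add c₀
        simpa using this
      have h1 : HasDerivAt (fun x => c₀ + F x + η * (1 + (x - a))) (src x + η) x := by
        have := hA.add hlin
        rw [mul_one] at this
        exact this
      have h2 : HasDerivAt (fun x => Real.exp (κ * I x)) (Real.exp (κ * I x) * (κ * cof x)) x :=
        ((hId x).const_mul κ).exp
      exact h1.mul h2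
    have hlinpos : ∀ x, a ≤ x → 0 < c₀ + F x + η * (1 + (x - a)) := by
      intro x hx
      have := hF0 x hx
      nlinarith
    have hBpos : ∀ x, a ≤ x → 0 < B x := fun x hx => mul_pos (hlinpos x hx) (Real.exp_pos _)
    -- at `a`
    have ha : E a ≤ B a * B a := by
      have hBa : B a = c₀ + η := by
        simp only [hBdef, hFa, hIa, sub_self, add_zero, mul_one, mul_zero, Real.exp_zero]
      rw [hBa]
      simp only [hEdef]
      rw [← hc₀def]
      nlinarith
    -- the strict derivative inequality at touching points
    have bound : ∀ x ∈ Ico a b, E x = B x * B x → D x < B' x * B x + B x * B' x := by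
      intro x hx hEx
      have hBx := hBpos x hx.1
      have hroot : h x = B x := by
        have h1 : (h x) ^ 2 = (B x) ^ 2 := by rw [sq (B x), ← hEx]
        have := congrArg Real.sqrt h1
        rwa [Real.sqrt_sq (hh0 x), Real.sqrt_sq hBx.le] at this
      have hDx := hD x hx
      rw [hroot] at hDx
      have hexpI : 1 ≤ Real.exp (κ * I x) := Real.one_le_exp (mul_nonneg hκ (hI0 x hx.1))
      -- `B' x ≥ (src x + η) + κ cof x · B x`
      have hB'ge : src x + η + κ * cof x * B x ≤ B' x := by
        have t1 : src x + η ≤ (src x + η) * Real.exp (κ * I x) := by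
          have := mul_le_mul_of_nonneg_left hexpI (add_nonneg (hsrc0 x) hη.le)
          simpa using this
        have t2 : κ * cof x * B x
            = (c₀ + F x + η * (1 + (x - a))) * (Real.exp (κ * I x) * (κ * cof x)) := by
          simp only [hBdef]; ring
        simp only [hB'def]
        linarith
      have : 2 * B x * src x + 2 * κ * cof x * B x ^ 2 < B' x * B x + B x * B' x := by
        nlinarith [mul_le_mul_of_nonneg_left hB'ge hBx.le]
      linarith
    have hfence := image_le_of_deriv_right_lt_deriv_boundary (f := E) (f' := D) (a := a) (b := b)
      hEc.continuousOn (fun x _ => (hE x).hasDerivWithinAt)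
      (B := fun x => B x * B x) (B' := fun x => B' x * B x + B x * B' x) ha
      (fun x => (hBd x).mul (hBd x)) bound
    have hEb : E b ≤ B b * B b := hfence ⟨hab, le_rfl⟩
    have hBb : 0 < B b := hBpos b hab
    have hfin : h b ≤ B b := by
      have h1 : (h b) ^ 2 ≤ (B b) ^ 2 := by rw [sq (B b)]; exact hEb
      have := Real.sqrt_le_sqrt h1
      rwa [Real.sqrt_sq (hh0 b), Real.sqrt_sq hBb.le] at this
    simpa only [hBdef] using hfin
  -- let `η → 0⁺`
  have hlim : h b ≤ (c₀ + F b) * Real.exp (κ * I b) := by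
    refine le_of_forall_pos_lt_add fun δ hδ => ?_
    have hX : 0 < (1 + (b - a)) * Real.exp (κ * I b) := by
      have : 0 < 1 + (b - a) := by linarith
      positivity
    set X : ℝ := (1 + (b - a)) * Real.exp (κ * I b) with hXdef
    have hkey := key (δ / (2 * X)) (by positivity)
    have hsplit : (c₀ + F b + δ / (2 * X) * (1 + (b - a))) * Real.exp (κ * I b)
        = (c₀ + F b) * Real.exp (κ * I b) + δ / (2 * X) * X := by rw [hXdef]; ring
    have hsmall : δ / (2 * X) * X = δ / 2 := by
      field_simp
    linarith
  calc h b ≤ (c₀ + F b) * Real.exp (κ * I b) := hlim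
    _ = Real.exp (κ * ∫ s in a..b, cof s) * (h a + ∫ s in a..b, src s) := by
        rw [hc₀def]; ring


/-! ## The damped fed-spike inequality and the dissipative shell step -/

section Dissipative

variable {m : ℕ} {ε₀ νh : ℝ} {α : Fin m → Fin m → Fin m → ℤ × ℤ × ℤ → ℝ} {W : ℤ → ℝ → Em m}

/-- The covariant viscosity coefficient decreases in log-time: `viscCoef(k, σ₀) ≤ viscCoef(k, x)` for
`x ≤ σ₀`. [cite: Tao2016AveragedNS, §4, the viscous equation before Thm. 4.2, §6.4; cell vocabulary] -/
theorem viscCoef_anti_time (hε : 0 < ε₀) (hν : 0 ≤ νh) (k : ℤ) {x σ₀ : ℝ} (hx : x ≤ σ₀) :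
    viscCoef ε₀ νh k σ₀ ≤ viscCoef ε₀ νh k x := by
  unfold viscCoef
  have h0 : 0 < 1 + ε₀ := by linarith
  refine mul_le_mul_of_nonneg_left ?_ hν
  refine mul_le_mul_of_nonneg_left (Real.exp_le_exp.2 (by linarith)) ?_
  positivity

/-- **Damped weight: the derivative.**  For every `Γ`, `(e^{(1+Γ)x}‖W_k(x)‖)² = e^{2Γx}·ẽ_k(x)` is
differentiable with the displayed derivative (product rule with `hasDerivAt_renE`).
[cite: Tao2016AveragedNS, §4 Lemma 4.1 (4.8)–(4.10) with (4.3), the viscous equation before Thm. 4.2, §6.4; cell vocabulary] -/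
theorem hasDerivAt_renE_damped (hc : IsCancellingCoeff α) (hW : IsEternalVisc ε₀ νh α W)
    (k : ℤ) (Γ x : ℝ) :
    HasDerivAt (fun x => (Real.exp ((1 + Γ) * x) * ‖W k x‖) ^ 2)
      (Real.exp (2 * Γ * x) * (2 * Γ) * (Real.exp (2 * x) * ‖W k x‖ ^ 2)
        + Real.exp (2 * Γ * x) *
          (Real.exp (2 * x) * (2 * bigLam ε₀ * ⟪W k x, tableA α (W (k - 1) x)⟫
            - 2 * (bigLam ε₀)⁻¹ * ⟪W (k + 1) x, tableA α (W k x)⟫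
            - 2 * viscCoef ε₀ νh k x * ‖W k x‖ ^ 2))) x := by
  have hR := hasDerivAt_renE hW hc k x
  have hG : HasDerivAt (fun x => Real.exp (2 * Γ * x)) (Real.exp (2 * Γ * x) * (2 * Γ)) x := by
    have := ((hasDerivAt_id x).const_mul (2 * Γ)).exp
    simpa using this
  have hprod := hG.mul hR
  have hfun : ((fun x => Real.exp (2 * Γ * x)) * fun x => Real.exp (2 * x) * ‖W k x‖ ^ 2)
      = fun x => (Real.exp ((1 + Γ) * x) * ‖W k x‖) ^ 2 := by
    funext y
    simp only [Pi.mul_apply]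
    have e1 : Real.exp ((1 + Γ) * y) * Real.exp ((1 + Γ) * y)
        = Real.exp (2 * Γ * y) * Real.exp (2 * y) := by
      rw [← Real.exp_add, ← Real.exp_add]; ring_nf
    calc Real.exp (2 * Γ * y) * (Real.exp (2 * y) * ‖W k y‖ ^ 2)
        = (Real.exp (2 * Γ * y) * Real.exp (2 * y)) * ‖W k y‖ ^ 2 := by ring
      _ = (Real.exp ((1 + Γ) * y) * ‖W k y‖) ^ 2 := by rw [← e1]; ring
  rw [hfun] at hprod
  exact hprod

/-- **Damped derivative bound.**  Wherever the damping of shell `k` is at least `Γ`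
(`Γ ≤ viscCoef(k, x)`), the derivative of `(e^{(1+Γ)x}‖W_k‖)²` is at most
`2(e^{(1+Γ)x}‖W_k‖)(ΛC_A e^{(1+Γ)x}‖W_{k-1}‖²) + 2(C_AΛ⁻¹)‖W_{k+1}‖(e^{(1+Γ)x}‖W_k‖)²`: the extra
weight `e^{Γx}` is absorbed by the dissipation.
[cite: Tao2016AveragedNS, §4 Lemma 4.1 (4.8)–(4.10) with (4.3), the viscous equation before Thm. 4.2, §6.4; cell vocabulary] -/
theorem renE_damped_deriv_le (hε : 0 < ε₀) (hc : IsCancellingCoeff α) (W : ℤ → ℝ → Em m)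
    (k : ℤ) {Γ x : ℝ} (hΓx : Γ ≤ viscCoef ε₀ νh k x) :
    Real.exp (2 * Γ * x) * (2 * Γ) * (Real.exp (2 * x) * ‖W k x‖ ^ 2)
        + Real.exp (2 * Γ * x) *
          (Real.exp (2 * x) * (2 * bigLam ε₀ * ⟪W k x, tableA α (W (k - 1) x)⟫
            - 2 * (bigLam ε₀)⁻¹ * ⟪W (k + 1) x, tableA α (W k x)⟫
            - 2 * viscCoef ε₀ νh k x * ‖W k x‖ ^ 2))
      ≤ 2 * (Real.exp ((1 + Γ) * x) * ‖W k x‖)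
          * (bigLam ε₀ * fluxConst α * (Real.exp ((1 + Γ) * x) * ‖W (k - 1) x‖ ^ 2))
        + 2 * (fluxConst α * (bigLam ε₀)⁻¹) * ‖W (k + 1) x‖
          * (Real.exp ((1 + Γ) * x) * ‖W k x‖) ^ 2 := by
  have hS := table_sTable α hc
  have hΛpos : 0 < bigLam ε₀ := bigLam_pos (by linarith)
  have hΛi : 0 ≤ (bigLam ε₀)⁻¹ := inv_nonneg.2 hΛpos.le
  have hCA : 0 ≤ fluxConst α := hS.CA_nonneg
  have hin1 : |⟪W k x, tableA α (W (k - 1) x)⟫| ≤ ‖W k x‖ * (fluxConst α * ‖W (k - 1) x‖ ^ 2) :=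
    (abs_real_inner_le_norm _ _).trans (mul_le_mul_of_nonneg_left (hS.normA _) (norm_nonneg _))
  have hin2 : |⟪W (k + 1) x, tableA α (W k x)⟫| ≤ ‖W (k + 1) x‖ * (fluxConst α * ‖W k x‖ ^ 2) :=
    (abs_real_inner_le_norm _ _).trans (mul_le_mul_of_nonneg_left (hS.normA _) (norm_nonneg _))
  have h1 : 2 * bigLam ε₀ * ⟪W k x, tableA α (W (k - 1) x)⟫
      ≤ 2 * bigLam ε₀ * (‖W k x‖ * (fluxConst α * ‖W (k - 1) x‖ ^ 2)) :=
    mul_le_mul_of_nonneg_left ((le_abs_self _).trans hin1) (by positivity)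
  have h2 : -(2 * (bigLam ε₀)⁻¹ * ⟪W (k + 1) x, tableA α (W k x)⟫)
      ≤ 2 * (bigLam ε₀)⁻¹ * (‖W (k + 1) x‖ * (fluxConst α * ‖W k x‖ ^ 2)) := by
    have := neg_abs_le ⟪W (k + 1) x, tableA α (W k x)⟫
    nlinarith
  have h3 : 2 * Γ * ‖W k x‖ ^ 2 ≤ 2 * viscCoef ε₀ νh k x * ‖W k x‖ ^ 2 :=
    mul_le_mul_of_nonneg_right (by linarith) (sq_nonneg _)
  have hexp : 0 < Real.exp (2 * Γ * x) * Real.exp (2 * x) := by positivity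
  have e2 : Real.exp ((1 + Γ) * x) * Real.exp ((1 + Γ) * x)
      = Real.exp (2 * Γ * x) * Real.exp (2 * x) := by
    rw [← Real.exp_add, ← Real.exp_add]; ring_nf
  have lhs : Real.exp (2 * Γ * x) * (2 * Γ) * (Real.exp (2 * x) * ‖W k x‖ ^ 2)
        + Real.exp (2 * Γ * x) *
          (Real.exp (2 * x) * (2 * bigLam ε₀ * ⟪W k x, tableA α (W (k - 1) x)⟫
            - 2 * (bigLam ε₀)⁻¹ * ⟪W (k + 1) x, tableA α (W k x)⟫
            - 2 * viscCoef ε₀ νh k x * ‖W k x‖ ^ 2))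
      = (Real.exp (2 * Γ * x) * Real.exp (2 * x)) *
        (2 * bigLam ε₀ * ⟪W k x, tableA α (W (k - 1) x)⟫
          - 2 * (bigLam ε₀)⁻¹ * ⟪W (k + 1) x, tableA α (W k x)⟫
          - 2 * viscCoef ε₀ νh k x * ‖W k x‖ ^ 2 + 2 * Γ * ‖W k x‖ ^ 2) := by ring
  have rhs : 2 * (Real.exp ((1 + Γ) * x) * ‖W k x‖)
          * (bigLam ε₀ * fluxConst α * (Real.exp ((1 + Γ) * x) * ‖W (k - 1) x‖ ^ 2))
        + 2 * (fluxConst α * (bigLam ε₀)⁻¹) * ‖W (k + 1) x‖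
          * (Real.exp ((1 + Γ) * x) * ‖W k x‖) ^ 2
      = (Real.exp (2 * Γ * x) * Real.exp (2 * x)) *
        (2 * bigLam ε₀ * (‖W k x‖ * (fluxConst α * ‖W (k - 1) x‖ ^ 2))
          + 2 * (bigLam ε₀)⁻¹ * (‖W (k + 1) x‖ * (fluxConst α * ‖W k x‖ ^ 2))) := by
    have : (Real.exp ((1 + Γ) * x) * ‖W k x‖) ^ 2
        = (Real.exp ((1 + Γ) * x) * Real.exp ((1 + Γ) * x)) * ‖W k x‖ ^ 2 := by ring
    rw [this, e2]
    have : 2 * (Real.exp ((1 + Γ) * x) * ‖W k x‖)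
          * (bigLam ε₀ * fluxConst α * (Real.exp ((1 + Γ) * x) * ‖W (k - 1) x‖ ^ 2))
        = (Real.exp ((1 + Γ) * x) * Real.exp ((1 + Γ) * x)) *
          (2 * bigLam ε₀ * (‖W k x‖ * (fluxConst α * ‖W (k - 1) x‖ ^ 2))) := by ring
    rw [this, e2]
    ring
  rw [lhs, rhs]
  exact mul_le_mul_of_nonneg_left (by linarith) hexp.le

/-- `∫_a^σ e^{(1+Γ)s} ds ≤ e^{(1+Γ)σ}/(1+Γ)` for `1 + Γ > 0`. [folklore] -/
theorem integral_exp_mul_le {Γ : ℝ} (hΓ : 0 < 1 + Γ) (a σ : ℝ) :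
    ∫ s in a..σ, Real.exp ((1 + Γ) * s) ≤ Real.exp ((1 + Γ) * σ) / (1 + Γ) := by
  have hd : ∀ s, HasDerivAt (fun s => Real.exp ((1 + Γ) * s) / (1 + Γ)) (Real.exp ((1 + Γ) * s)) s := by
    intro s
    have h1 : HasDerivAt (fun s => Real.exp ((1 + Γ) * s)) (Real.exp ((1 + Γ) * s) * (1 + Γ)) s := by
      have := ((hasDerivAt_id s).const_mul (1 + Γ)).exp
      simpa using this
    have := h1.div_const (1 + Γ)
    refine this.congr_deriv ?_
    field_simp
  rw [integral_eq_sub_of_hasDerivAt (fun s _ => hd s)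
    ((by fun_prop : Continuous fun s => Real.exp ((1 + Γ) * s)).intervalIntegrable _ _)]
  have : 0 ≤ Real.exp ((1 + Γ) * a) / (1 + Γ) := by positivity
  linarith

end Dissipative

end WakeRatchetDampedFedSpike

end Summit.NavierStokesRegularity.NavierStokesRegularity.Theorems

end
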